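import Summits.QuantumFields.BalabanUV.Beta.SecondOrderStepRemainder

/-!
# `BalabanUV.Beta.SecondOrderStepRemainderWall` — binder row D1, the W-side (L4) of the reflection binder hR, leaf (W-REM-PAR), part 2:
# THE WALL INSTANCE of `SecondOrderStepRemainder` — `G := G_j = coDressKBmAt (toSite r) Lc (KInvStep Lc j)`, `N := Lc`, tadpole against `G_i`,
# and the transported remainder AS the sandwiched level-`j` residual `R₀ := G_j ∘ V ∘ G_j`
# (β sub-cell, D1 formalisation swarm seat `b2b-balaban-beta-d1-formalise-leaf-05`, gen 5; typer-g4 DAG v10.1 row (W-REM-PAR), owner an2-g18 l.11369 (iv))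

HONEST FRAMING (cell contract, verbatim): «discharging `BetaPertH` makes Bałaban's UV stability UNCONDITIONAL — a real
constructive-QFT result; it is NOT the continuum limit and NOT the Clay problem.»  HONEST DEPENDENCY (verbatim): «continuum YM on T⁴ ⇐
BetaPertH ∧ nine spine estimates (0/9 proved); BetaPertH ⇐ (D1) ∧ (D4) ∧ CAP+tail; G-an2-4 gates asym, D1 and NE2/3/4.»  [folklore]
bookkeeping over tree objects BY NAME; no statement of Bałaban's papers, no `[cite:]` tag, no `def`, no `Prop` fact; instantiates NO binder of
the β-function wall; NOT D1, NOT `BetaPertH`, NOT continuum, NOT Clay.  ABSOLUTE RULE (cell, verbatim): «No internally-minted statement may enter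
as a cited fact. Every hypothesis is either kernel-proved in this package or a verbatim quotation of a PUBLISHED theorem with page reference. The
manuscript(s) under audit are NOT citable for their own disputed steps — they are the thing under adjudication; programme-internal
(2001/route/tribunal) claims are never citable.»  Nothing is cited here.

## What is proved (generic `d`, `Lc ≥ 1`, ANY in-block root `toSite r`, all levels `i`, `j`, any coefficients `a`, `w`, any second symbols)

* `trK_mmRead_stepProp`: the `mm`-read of every step propagator is sgn-symmetric.
* `parityOdd_stepRemainder_stepProp`, `locStencil₂_stepRemainder_stepProp` (∃-rate form, all classes matched to a common rate with the decay of `G_j`),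
  **`tadpole_stepRemainder_stepProp_eq_zero`**: the displayed remainder of `SecondOrderStepLaw.quarticStep_bref_of_laws` over `G := G_j`, read
  at blocking `Lc`, has zero tadpole against every `G_i` — hypotheses on `R₀` (parity of rows + `LocStencil₂` of its `mm`-read), `RB` (parity +
  `LocStencil₂`), and the decay classes of `ĥ`, `hB` only.
* **`tadpole_stepRemainder_stepProp_eq_zero_of_residual`**: the same with `R₀ κuκ′u′ := G_j ∘ V κuκ′u′ ∘ G_j` (the last term of
  `SecondOrderStepEval.mmRead_K3OfK_stepProp_bref`), from `V` parity-odd and bi-localised at the dilated bond `(Lc•u, Lc•u)` with a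
  separation-decaying constant at SOME rate — the typer's (PAR)+(LOC) of DAG v10.1 row (W-REM-PAR), assembled; the level step uses `i = j + 1`.
Provenance: b2b-balaban β sub-cell, D1 formalisation swarm leaf-05 gen 5, 2026-08-20 (v1); no existing file touched.
-/

noncomputable section

open Finset
open scoped BigOperators
open Literature.MathematicalPhysics.QuantumFieldTheory
open Literature.MathematicalPhysics.QuantumFieldTheory.Balaban1983to89
open Literature.MathematicalPhysics.QuantumFieldTheory.Balaban1983to89.Beta
open B12Sec2to5 (l1 l1_nonneg)
open ExpKernelCalculus (MKer Decays BiLoc comp tadpole)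
open AffineAveraging (box toSite)
open OneStepResolventKernel (Fib decays_mono)
open OneStepKernelFamily (KInvStep)
open BalabanStepJetsSucc (mmRead)
open BalabanCompositeJets (LocStencil₂)
open BalabanStepW2 (biLoc_le_mono)
open Summit.QuantumFields.BalabanUV.Beta.TameKernelCalculus
open Summit.QuantumFields.BalabanUV.Beta.BorderedHessian (sgnK diagK)
open Summit.QuantumFields.BalabanUV.Beta.BubbleParity (spr_of_decays trK_coDressKBmAt_KInvStep)
open Summit.QuantumFields.BalabanUV.Beta.ChartConjugation (conjV)
open Summit.QuantumFields.BalabanUV.Beta.AxialDressingRooted (coDressKBmAt decays_coDressKBmAt_KInvStep)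
open Summit.QuantumFields.BalabanUV.Beta.KernelWardRelativeEnd (tadpole_eq_zero_of_parity)
open Summit.QuantumFields.BalabanUV.Beta.SpineRecursiveParity (parityOdd_sandwich)
open Summit.QuantumFields.BalabanUV.Beta.SecondOrderStepRemainder

namespace Summit.QuantumFields.BalabanUV.Beta.SecondOrderStepRemainderWall

variable {d : ℕ}

section Wall

variable {Lc : ℕ} [NeZero Lc]
  {R₀ RB : Fin (d + 1) → (Fin (d + 1) → ℤ) → Fin (d + 1) → (Fin (d + 1) → ℤ) → MKer (d + 1) (Fib d)}

/-- [folklore] The `mm`-read of every step propagator is sgn-symmetric (`BubbleParity.trK_coDressKBmAt_KInvStep` + `parityEven_mmRead`). -/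
theorem trK_mmRead_stepProp {r : Fin (d + 1) → ℕ} (hr : r ∈ box (d + 1) Lc) (M : ℕ) (j : ℕ) :
    trK (mmRead M (coDressKBmAt (toSite r) Lc (KInvStep (d := d) Lc j))) = sgnK (mmRead M (coDressKBmAt (toSite r) Lc (KInvStep (d := d) Lc j))) :=
  parityEven_mmRead M (trK_coDressKBmAt_KInvStep hr j)

/-- [folklore] **THE WALL's REMAINDER ROWS ARE PARITY-ODD**: the displayed remainder over `G := G_j`, read at blocking `Lc`, for parity-odd rows of
`R₀` and `RB`, ANY coefficients and second symbols. -/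
theorem parityOdd_stepRemainder_stepProp {r : Fin (d + 1) → ℕ} (hr : r ∈ box (d + 1) Lc) (j : ℕ)
    (h₀ : ∀ κ u κ' u', trK (R₀ κ u κ' u') = -sgnK (R₀ κ u κ' u')) (hB : ∀ κ u κ' u', trK (RB κ u κ' u') = -sgnK (RB κ u κ' u'))
    (a w : ℝ) (hh hB' : Fin (d + 1) → (Fin (d + 1) → ℤ) → Fin (d + 1) → (Fin (d + 1) → ℤ) → (Fin (d + 1) → ℤ) → Fib d → ℝ)
    (κ : Fin (d + 1)) (u : Fin (d + 1) → ℤ) (κ' : Fin (d + 1)) (u' : Fin (d + 1) → ℤ) :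
    trK (-(a • mmRead Lc (R₀ κ u κ' u')) + RB κ u κ' u' +
        conjV (mmRead Lc (coDressKBmAt (toSite r) Lc (KInvStep (d := d) Lc j))) (diagK fun p c => a * hh κ u κ' u' p c - w * hB' κ u κ' u' p c)) =
      -sgnK (-(a • mmRead Lc (R₀ κ u κ' u')) + RB κ u κ' u' +
        conjV (mmRead Lc (coDressKBmAt (toSite r) Lc (KInvStep (d := d) Lc j))) (diagK fun p c => a * hh κ u κ' u' p c - w * hB' κ u κ' u' p c)) :=
  parityOdd_stepRemainder (trK_coDressKBmAt_KInvStep hr j) h₀ hB a w hh hB' κ u κ' u'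

/-- [folklore] **THE WALL's REMAINDER IS A `LocStencil₂` FAMILY** (some rate), from the classes of `R₀` (read), `RB`, `ĥ`, `hB` given at SOME
positive rates (all matched to a common rate with the decay of `G_j` by monotonicity). -/
theorem locStencil₂_stepRemainder_stepProp (hLc : 1 ≤ Lc) {r : Fin (d + 1) → ℕ} (hr : r ∈ box (d + 1) Lc) (j : ℕ)
    (h₀ : ∃ C₀ δ₀ : ℝ, 0 < δ₀ ∧ LocStencil₂ (fun κ u κ' u' => mmRead Lc (R₀ κ u κ' u')) C₀ δ₀)
    (hB : ∃ CB δB : ℝ, 0 < δB ∧ LocStencil₂ RB CB δB) (a w : ℝ)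
    {hh hB' : Fin (d + 1) → (Fin (d + 1) → ℤ) → Fin (d + 1) → (Fin (d + 1) → ℤ) → (Fin (d + 1) → ℤ) → Fib d → ℝ}
    (hhl : ∃ Ch δh : ℝ, 0 < δh ∧ LocStencil₂ (fun κ u κ' u' => diagK (hh κ u κ' u')) Ch δh)
    (hbl : ∃ Cb δb : ℝ, 0 < δb ∧ LocStencil₂ (fun κ u κ' u' => diagK (hB' κ u κ' u')) Cb δb) :
    ∃ C δ : ℝ, 0 < δ ∧ LocStencil₂ (fun κ u κ' u' => -(a • mmRead Lc (R₀ κ u κ' u')) + RB κ u κ' u' +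
      conjV (mmRead Lc (coDressKBmAt (toSite r) Lc (KInvStep (d := d) Lc j))) (diagK fun p c => a * hh κ u κ' u' p c - w * hB' κ u κ' u' p c)) C δ := by
  obtain ⟨δG, CG, hδG, hCG, hG⟩ := decays_coDressKBmAt_KInvStep (d := d) hr j
  obtain ⟨C₀, δ₀, hδ₀, h₀⟩ := h₀
  obtain ⟨CB, δB, hδB, hB⟩ := hB
  obtain ⟨Ch, δh, hδh, hhl⟩ := hhl
  obtain ⟨Cb, δb, hδb, hbl⟩ := hbl
  set m : ℝ := min (min δG δ₀) (min δB (min δh δb)) with hm_def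
  have hm : 0 < m := lt_min (lt_min hδG hδ₀) (lt_min hδB (lt_min hδh hδb))
  have hmG : m ≤ δG := (min_le_left _ _).trans (min_le_left _ _)
  have hm₀ : m ≤ δ₀ := (min_le_left _ _).trans (min_le_right _ _)
  have hmB : m ≤ δB := (min_le_right _ _).trans (min_le_left _ _)
  have hmh : m ≤ δh := (min_le_right _ _).trans ((min_le_right _ _).trans (min_le_left _ _))
  have hmb : m ≤ δb := (min_le_right _ _).trans ((min_le_right _ _).trans (min_le_right _ _))
  exact ⟨_, m / 2, half_pos hm, locStencil₂_stepRemainder hLc hm (decays_mono hG hCG le_rfl hmG) (h₀.mono hm₀) (hB.mono hmB) a w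
    (hhl.mono hmh) (hbl.mono hmb)⟩

/-- [folklore] **ZERO TADPOLE AT THE WALL**: against every step propagator `G_i`, every member of the displayed remainder over `G := G_j` (read at
blocking `Lc`) vanishes in the tadpole — for parity-odd rows of `R₀`, `RB` and the stated local classes; the level step uses `i = j + 1`. -/
theorem tadpole_stepRemainder_stepProp_eq_zero (hLc : 1 ≤ Lc) {r : Fin (d + 1) → ℕ} (hr : r ∈ box (d + 1) Lc) (i j : ℕ)
    (h₀l : ∃ C₀ δ₀ : ℝ, 0 < δ₀ ∧ LocStencil₂ (fun κ u κ' u' => mmRead Lc (R₀ κ u κ' u')) C₀ δ₀)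
    (h₀ : ∀ κ u κ' u', trK (R₀ κ u κ' u') = -sgnK (R₀ κ u κ' u'))
    (hBl : ∃ CB δB : ℝ, 0 < δB ∧ LocStencil₂ RB CB δB) (hB : ∀ κ u κ' u', trK (RB κ u κ' u') = -sgnK (RB κ u κ' u')) (a w : ℝ)
    {hh hB' : Fin (d + 1) → (Fin (d + 1) → ℤ) → Fin (d + 1) → (Fin (d + 1) → ℤ) → (Fin (d + 1) → ℤ) → Fib d → ℝ}
    (hhl : ∃ Ch δh : ℝ, 0 < δh ∧ LocStencil₂ (fun κ u κ' u' => diagK (hh κ u κ' u')) Ch δh)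
    (hbl : ∃ Cb δb : ℝ, 0 < δb ∧ LocStencil₂ (fun κ u κ' u' => diagK (hB' κ u κ' u')) Cb δb)
    (κ : Fin (d + 1)) (u : Fin (d + 1) → ℤ) (κ' : Fin (d + 1)) (u' : Fin (d + 1) → ℤ) :
    tadpole (coDressKBmAt (toSite r) Lc (KInvStep (d := d) Lc i))
      (-(a • mmRead Lc (R₀ κ u κ' u')) + RB κ u κ' u' +
        conjV (mmRead Lc (coDressKBmAt (toSite r) Lc (KInvStep (d := d) Lc j)))
          (diagK fun p c => a * hh κ u κ' u' p c - w * hB' κ u κ' u' p c)) = 0 := by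
  obtain ⟨C, δ, hδ, hR⟩ := locStencil₂_stepRemainder_stepProp hLc hr j h₀l hBl a w hhl hbl
  exact tadpole_eq_zero_of_parity (spr_of_decays (decays_coDressKBmAt_KInvStep hr i)) (trK_coDressKBmAt_KInvStep hr i)
    (loc_of_locStencil₂ hR hδ κ u κ' u') (parityOdd_stepRemainder_stepProp hr j h₀ hB a w hh hB' κ u κ' u')

/-- [folklore] **ZERO TADPOLE AT THE WALL, TRANSPORTED REMAINDER AS THE SANDWICHED RESIDUAL** `R₀ κuκ′u′ := G_j ∘ V κuκ′u′ ∘ G_j` (the last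
term of `SecondOrderStepEval.mmRead_K3OfK_stepProp_bref`; `V` = the level-`j` W-law residual): rows of `V` parity-odd and bi-localised at the
dilated bond with a separation-decaying constant at SOME rate, rows of `RB` parity-odd and `LocStencil₂` at SOME rate, the two second symbols
local at SOME rates ⇒ every member of the displayed remainder has zero tadpole against every `G_i` — the typer's (PAR)+(LOC) of DAG v10.1 row
(W-REM-PAR) assembled (`parityOdd_sandwich`, `locStencil₂_mmRead_sandwich`). -/
theorem tadpole_stepRemainder_stepProp_eq_zero_of_residual (hLc : 1 ≤ Lc) {r : Fin (d + 1) → ℕ} (hr : r ∈ box (d + 1) Lc) (i j : ℕ)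
    {V : Fin (d + 1) → (Fin (d + 1) → ℤ) → Fin (d + 1) → (Fin (d + 1) → ℤ) → MKer (d + 1) (Fib d)}
    (hVl : ∃ Cv δv : ℝ, 0 < δv ∧ ∀ κ u κ' u', BiLoc (V κ u κ' u') ((Lc : ℤ) • u) ((Lc : ℤ) • u) (Cv * Real.exp (-δv * l1 (u' - u))) δv)
    (hVt : ∀ κ u κ' u', trK (V κ u κ' u') = -sgnK (V κ u κ' u'))
    (hBl : ∃ CB δB : ℝ, 0 < δB ∧ LocStencil₂ RB CB δB) (hB : ∀ κ u κ' u', trK (RB κ u κ' u') = -sgnK (RB κ u κ' u')) (a w : ℝ)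
    {hh hB' : Fin (d + 1) → (Fin (d + 1) → ℤ) → Fin (d + 1) → (Fin (d + 1) → ℤ) → (Fin (d + 1) → ℤ) → Fib d → ℝ}
    (hhl : ∃ Ch δh : ℝ, 0 < δh ∧ LocStencil₂ (fun κ u κ' u' => diagK (hh κ u κ' u')) Ch δh)
    (hbl : ∃ Cb δb : ℝ, 0 < δb ∧ LocStencil₂ (fun κ u κ' u' => diagK (hB' κ u κ' u')) Cb δb)
    (κ : Fin (d + 1)) (u : Fin (d + 1) → ℤ) (κ' : Fin (d + 1)) (u' : Fin (d + 1) → ℤ) :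
    tadpole (coDressKBmAt (toSite r) Lc (KInvStep (d := d) Lc i))
      (-(a • mmRead Lc (comp (comp (coDressKBmAt (toSite r) Lc (KInvStep (d := d) Lc j)) (V κ u κ' u'))
          (coDressKBmAt (toSite r) Lc (KInvStep (d := d) Lc j)))) + RB κ u κ' u' +
        conjV (mmRead Lc (coDressKBmAt (toSite r) Lc (KInvStep (d := d) Lc j)))
          (diagK fun p c => a * hh κ u κ' u' p c - w * hB' κ u κ' u' p c)) = 0 := by
  obtain ⟨δG, CG, hδG, hCG, hG⟩ := decays_coDressKBmAt_KInvStep (d := d) hr j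
  obtain ⟨Cv, δv, hδv, hV⟩ := hVl
  -- one common rate for `G_j` and `V`, then the sandwich is a `LocStencil₂` family
  set m : ℝ := min δG δv with hm_def
  have hm : 0 < m := lt_min hδG hδv
  have hGm : Decays (coDressKBmAt (toSite r) Lc (KInvStep (d := d) Lc j)) CG m := decays_mono hG hCG le_rfl (min_le_left _ _)
  have hVm : ∀ κ u κ' u', BiLoc (V κ u κ' u') ((Lc : ℤ) • u) ((Lc : ℤ) • u) (Cv * Real.exp (-m * l1 (u' - u))) m := by
    intro κ u κ' u'
    have hCvu : 0 ≤ Cv * Real.exp (-δv * l1 (u' - u)) := (hV κ u κ' u').nonneg (Sum.inl 0)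
    have hCv : 0 ≤ Cv := (mul_nonneg_iff_of_pos_right (Real.exp_pos _)).mp hCvu
    refine biLoc_le_mono (hV κ u κ' u') hCvu (mul_le_mul_of_nonneg_left (Real.exp_le_exp.2 ?_) hCv) (min_le_right _ _)
    nlinarith [l1_nonneg (u' - u), min_le_right δG δv]
  have h₀l : ∃ C₀ δ₀ : ℝ, 0 < δ₀ ∧ LocStencil₂ (fun κ u κ' u' => mmRead Lc
      (comp (comp (coDressKBmAt (toSite r) Lc (KInvStep (d := d) Lc j)) (V κ u κ' u')) (coDressKBmAt (toSite r) Lc (KInvStep (d := d) Lc j))))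
      C₀ δ₀ :=
    ⟨_, m / 4, by positivity, locStencil₂_mmRead_sandwich hLc hGm hm hVm⟩
  have h₀ : ∀ κ u κ' u', trK (comp (comp (coDressKBmAt (toSite r) Lc (KInvStep (d := d) Lc j)) (V κ u κ' u'))
      (coDressKBmAt (toSite r) Lc (KInvStep (d := d) Lc j))) =
      -sgnK (comp (comp (coDressKBmAt (toSite r) Lc (KInvStep (d := d) Lc j)) (V κ u κ' u')) (coDressKBmAt (toSite r) Lc (KInvStep (d := d) Lc j))) :=
    fun κ u κ' u' => parityOdd_sandwich (spr_of_decays (decays_coDressKBmAt_KInvStep hr j)) ⟨_, _, _, δv, hδv, hV κ u κ' u'⟩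
      (trK_coDressKBmAt_KInvStep hr j) (hVt κ u κ' u')
  exact tadpole_stepRemainder_stepProp_eq_zero hLc hr i j
    (R₀ := fun κ u κ' u' => comp (comp (coDressKBmAt (toSite r) Lc (KInvStep (d := d) Lc j)) (V κ u κ' u'))
      (coDressKBmAt (toSite r) Lc (KInvStep (d := d) Lc j)))
    h₀l h₀ hBl hB a w hhl hbl κ u κ' u'

end Wall

end Summit.QuantumFields.BalabanUV.Beta.SecondOrderStepRemainderWall

end
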